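import Literature.Analysis.FluidPDE.SereginSverakBlowup
import Literature.Analysis.FluidPDE.SereginSverakBlowupSelection
import HarnessLib

/-!
# Seregin–Šverák 2009, §4: the rescaled pairs meet the hypotheses of the compactness step

G. Seregin, V. Šverák, *On Type I singularities of the local axi-symmetric solutions of the
Navier–Stokes equations*, Comm. PDE 34 (2009) = arXiv:0804.1803, §4 (arXiv p. 11). For the
axis-centred Navier–Stokes rescaling of §4,
`u^k(y,s) = λ v(λ y', x_{k,3} + λ y₃, t_k + λ² s)`, `p^k = λ² q(…)` — in the tree's notation
`c • stPull (c²) c t_k (x_{k,3} e₃) u`, `c² • stPull (c²) c t_k (x_{k,3} e₃) p` with `c = λ`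
(`Literature.Analysis.FluidPDE.SpaceTimeRescaling`) —, this file PROVES, one by one, the
hypotheses of the compactness fact `SereginSverak2009.BlowupCompactness`
(`Literature.Analysis.FluidPDE.SereginSverakBlowup`) on every cylinder `Q(0, R)` that the
rescaling maps into the controlled backward cylinder of the selection
(`Literature.Analysis.FluidPDE.SereginSverakBlowupSelection`):

* `isDistributional_rescaled` — the rescaled pair solves Navier–Stokes in `Q(0, R)`
  (covariance `IsDistributionalNSSolutionOn.stRescale`, `α = γ = c`, `β = c²`, and restriction);
* `lintegral_pressure_rescaled` — the pressure bound at the blow-up centre from a bound on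
  `D((0, x₀), r')`, `r'² = (ac)² - t_k`, when `-t_k ≤ 4C²c²` (the Type I relation at `z_k`):
  `∫_{Q(0,a)} |c² p ∘ Φ|^{3/2} ≤ (a² + 4C²) C₁`;
* `ae_norm_rescaled_le_one` ((p5)), `isAxisymmetric_rescaled_slice` (axial symmetry of the
  slices), `ae_decay_rescaled` ((p2) is scale invariant), `continuousOn_rescaled` (continuity of
  `c v ∘ Φ` up to `s = 0`).

The reductions themselves are in `SereginSverakBlowupProofs` (Thm. 3.1) and
`SereginSverakBlowupDecay` (Thm. 3.2 and the accepted `BlowupAlternative`).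

## References

* G. Seregin, V. Šverák, Comm. PDE 34 (2009), arXiv:0804.1803, §4 p. 11 ((p2)–(p5), (p10),
  the estimate on `F^k`). [`SereginSverak2009`]
-/

noncomputable section

open MeasureTheory Set Function Filter Topology TopologicalSpace Module
open scoped NNReal ENNReal

namespace Literature.Analysis.FluidPDE

namespace SereginSverak2009

/-- Local notation for physical space `ℝ³ = EuclideanSpace ℝ (Fin 3)`. -/
local notation "ℝ³" => EuclideanSpace ℝ (Fin 3)

/-! ### The rescaled pair solves Navier–Stokes -/

/-- The axis-centred Navier–Stokes rescaling `U = c u ∘ Φ`, `P = c² p ∘ Φ`,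
`Φ(s, y) = (t_k + c² s, x₀ + c y)`, of a distributional solution in `Q` is a distributional
solution (`ν = 1`, no force) in every cylinder `Q(0, R)` that `Φ` maps into `Q`
(`IsDistributionalNSSolutionOn.stRescale` with `α = γ = c`, `β = c²`, then restriction).
[cite: SereginSverak2009, §4 ("These functions satisfy the Navier–Stokes equations in `Q(M_k)`", arXiv p. 11)] -/
theorem isDistributional_rescaled {u : ℝ → ℝ³ → ℝ³} {p : ℝ → ℝ³ → ℝ}
    (h : IsDistributionalNSSolutionOn (parCylOpens 0 1) 1 0 u p) {c : ℝ} (hc : 0 < c) (tk : ℝ)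
    (x₀ : ℝ³) {R : ℝ} (hR : parCyl 0 R ⊆ stAffine (c ^ 2) c tk x₀ ⁻¹' parCyl 0 1) :
    IsDistributionalNSSolutionOn (parCylOpens 0 R) 1 0 (c • stPull (c ^ 2) c tk x₀ u)
      (c ^ 2 • stPull (c ^ 2) c tk x₀ p) := by
  have h1 := h.stRescale hc hc (show c ^ 2 = c * c by ring) tk x₀
  have hν : c * 1 / c = 1 := by field_simp
  have hf : (c ^ 2 * c) • stPull (c ^ 2) c tk x₀ (0 : ℝ → ℝ³ → ℝ³) = 0 := by
    funext s y
    simp [stPull]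
  rw [hν, hf] at h1
  exact h1.of_le fun z hz => hR hz

/-! ### The rescaled pressure bound -/

/-- Real-number core of the pressure bookkeeping: with `r'² = (ac)² - t_k` and
`-t_k ≤ 4C²c²`, `c³ (c² c³)⁻¹ r'² ≤ a² + 4C²`. [folklore] -/
theorem rescaled_radius_bound {a c tk C : ℝ} (hc : 0 < c) (htkc : -tk ≤ 4 * C ^ 2 * c ^ 2) :
    c ^ 3 * (c ^ 2 * c ^ 3)⁻¹ * ((a * c) ^ 2 - tk) ≤ a ^ 2 + 4 * C ^ 2 := by
  have hc2 : 0 < c ^ 2 := by positivity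
  have e : c ^ 3 * (c ^ 2 * c ^ 3)⁻¹ * ((a * c) ^ 2 - tk) = a ^ 2 + (-tk) / c ^ 2 := by
    field_simp
    ring
  rw [e, add_le_add_iff_left, div_le_iff₀ hc2]
  exact htkc

/-- **The pressure bound at the blow-up centres** (the content of "`‖F^k‖_{3/2,Q(4a)} ≤ c₁(a)`"
for the pressure part, obtained from Lemma 3.5 and (r3) as explained in the module docstring of
`SereginSverakBlowup`): if `c > 0`, `a > 0`, `t_k ≤ 0`, `-t_k ≤ 4C²c²`, and the pressure
functional at the axis centre `(0, x₀)` and radius `r' = √((ac)² - t_k)` is at most `C₁`, then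
`∫_{Q(0,a)} |c² p ∘ Φ|^{3/2} ≤ (a² + 4C²) C₁`. [cite: SereginSverak2009, §4 (the estimate on `F^k` after (p11), arXiv p. 11) with Lemma 3.5] -/
theorem lintegral_pressure_rescaled {p : ℝ → ℝ³ → ℝ} {c a tk C : ℝ} {x₀ : ℝ³} {C₁ : ℝ≥0}
    (hc : 0 < c) (ha : 0 < a) (htk : tk ≤ 0) (htkc : -tk ≤ 4 * C ^ 2 * c ^ 2)
    (hD : pressureD ((0 : ℝ), x₀) (Real.sqrt ((a * c) ^ 2 - tk)) p ≤ C₁) :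
    ∫⁻ z in parCyl 0 a, ‖(c ^ 2 • stPull (c ^ 2) c tk x₀ p) z.1 z.2‖ₑ ^ (3 / 2 : ℝ) ≤
      ENNReal.ofReal (a ^ 2 + 4 * C ^ 2) * C₁ := by
  set r' := Real.sqrt ((a * c) ^ 2 - tk) with hr'
  have hac : 0 < a * c := mul_pos ha hc
  have hsq0 : 0 ≤ (a * c) ^ 2 - tk := by nlinarith
  have hr'sq : r' ^ 2 = (a * c) ^ 2 - tk := Real.sq_sqrt hsq0
  have hr'pos : 0 < r' := Real.sqrt_pos.2 (by nlinarith)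
  have hacr : a * c ≤ r' := by
    rw [hr', Real.le_sqrt hac.le hsq0]
    linarith
  have hdom : parCyl (0 : ℝ × ℝ³) a = stAffine (c ^ 2) c tk x₀ ⁻¹' parCyl (tk, x₀) (a * c) := by
    rw [stAffine_preimage_parCyl hc, mul_div_cancel_right₀ _ hc.ne']
  rw [hdom, setLIntegral_enorm_rpow_stRescale (by positivity) hc tk x₀ (c ^ 2) p _
    (by norm_num : (0 : ℝ) ≤ 3 / 2), finrank_euclideanSpace_fin]
  have hsub : parCyl (tk, x₀) (a * c) ⊆ parCyl ((0 : ℝ), x₀) r' :=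
    parCyl_subset_parCyl_zero_time htk hacr (by rw [hr'sq])
  have hint : ∫⁻ z in parCyl (tk, x₀) (a * c), ‖p z.1 z.2‖ₑ ^ (3 / 2 : ℝ) ≤
      ENNReal.ofReal (r' ^ 2) * C₁ := by
    refine (lintegral_mono_set hsub).trans ?_
    rw [setLIntegral_eq_mul_pressureD _ hr'pos, ← ENNReal.ofReal_pow hr'pos.le]
    gcongr
  have e1 : ‖c ^ 2‖ₑ ^ (3 / 2 : ℝ) = ENNReal.ofReal (c ^ 3) := by
    rw [Real.enorm_eq_ofReal (sq_nonneg c), ENNReal.ofReal_rpow_of_nonneg (sq_nonneg c)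
      (by norm_num)]
    congr 1
    rw [← Real.rpow_natCast c 2, ← Real.rpow_mul hc.le, ← Real.rpow_natCast c 3]
    norm_num
  rw [e1]
  calc ENNReal.ofReal (c ^ 3) * ENNReal.ofReal (c ^ 2 * c ^ 3)⁻¹ *
        ∫⁻ z in parCyl (tk, x₀) (a * c), ‖p z.1 z.2‖ₑ ^ (3 / 2 : ℝ)
      ≤ ENNReal.ofReal (c ^ 3) * ENNReal.ofReal (c ^ 2 * c ^ 3)⁻¹ *
        (ENNReal.ofReal (r' ^ 2) * C₁) := by gcongr
    _ = ENNReal.ofReal (c ^ 3 * (c ^ 2 * c ^ 3)⁻¹ * ((a * c) ^ 2 - tk)) * C₁ := by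
        rw [← hr'sq, ENNReal.ofReal_mul (by positivity), ENNReal.ofReal_mul (by positivity)]
        ring
    _ ≤ ENNReal.ofReal (a ^ 2 + 4 * C ^ 2) * C₁ := by
        gcongr
        exact rescaled_radius_bound hc htkc

/-! ### The other hypotheses of `BlowupCompactness` for the rescaled pair -/

/-- **(p5) for the rescaled field**: if `‖v‖ ≤ B` on the backward cylinder of size `σ` about `z_k`,
`c B ≤ 1`, `Φ` maps `Q(0, R)` into that cylinder, and `v ∘ Φ = u ∘ Φ` a.e. on `Q(0, R)`, then
`‖c u ∘ Φ‖ ≤ 1` a.e. on `Q(0, R)`. [cite: SereginSverak2009, §4 (p5) (arXiv p. 11)] -/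
theorem ae_norm_rescaled_le_one {u : ℝ → ℝ³ → ℝ³} {v : ℝ × ℝ³ → ℝ³} {c σ R B : ℝ} (hc : 0 < c)
    (zk : ℝ × ℝ³) (hR : R + cylRadius (c⁻¹ • horiz zk.2) ≤ σ / c)
    (hbd : ∀ z ∈ backCyl zk σ, ‖v z‖ ≤ B) (hcB : c * B ≤ 1)
    (hae : ∀ᵐ z ∂(volume.restrict (parCyl 0 R)),
      v (stAffine (c ^ 2) c zk.1 (zk.2 2 • eZ) z) =
        uncurry u (stAffine (c ^ 2) c zk.1 (zk.2 2 • eZ) z)) :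
    ∀ᵐ z ∂(volume.restrict (parCyl 0 R)),
      ‖(c • stPull (c ^ 2) c zk.1 (zk.2 2 • eZ) u) z.1 z.2‖ ≤ 1 := by
  filter_upwards [hae, ae_restrict_mem (isOpen_parCyl 0 R).measurableSet] with z hz hzmem
  have hzb := stAffine_mem_backCyl hc zk hR hzmem
  have e : u (zk.1 + c ^ 2 * z.1) (zk.2 2 • eZ + c • z.2) =
      v (stAffine (c ^ 2) c zk.1 (zk.2 2 • eZ) z) := hz.symm
  rw [smul_stPull_apply, e, norm_smul, Real.norm_eq_abs, abs_of_pos hc]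
  calc c * ‖v (stAffine (c ^ 2) c zk.1 (zk.2 2 • eZ) z)‖ ≤ c * B :=
        mul_le_mul_of_nonneg_left (hbd _ hzb) hc.le
    _ ≤ 1 := hcB

/-- **Axial symmetry of the rescaled slices**: the rescaling is centred on the axis, so every
slice `U(s) = c u(t_k + c² s, x_{k,3} e₃ + c ·)`, `-R² < s < 0`, is axisymmetric as soon as the
corresponding time lies in `]-1, 0[`, which holds when `Φ` maps `Q(0, R)` into `Q`.
[cite: SereginSverak2009, §4 ("scaled functions possess axial symmetry", arXiv p. 11)] -/
theorem isAxisymmetric_rescaled_slice {u : ℝ → ℝ³ → ℝ³}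
    (haxi : ∀ t ∈ Ioo (-1 : ℝ) 0, IsAxisymmetric (u t)) {c R : ℝ} (hR : 0 < R) (zk : ℝ × ℝ³)
    (hmaps : parCyl 0 R ⊆ stAffine (c ^ 2) c zk.1 (zk.2 2 • eZ) ⁻¹' parCyl 0 1) {s : ℝ}
    (hs : s ∈ Ioo (-R ^ 2) 0) :
    IsAxisymmetric ((c • stPull (c ^ 2) c zk.1 (zk.2 2 • eZ) u) s) := by
  have h1 := hmaps (mem_parCyl_zero_of_time hR hs)
  rw [mem_preimage, mem_parCyl_zero, stAffine_fst] at h1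
  have ht : zk.1 + c ^ 2 * s ∈ Ioo (-1 : ℝ) 0 := by simpa using h1.1
  exact isAxisymmetric_rescale (haxi _ ht) c (zk.2 2) c

/-- **(p2) is scale invariant**: the a.e. bound `|x'| ‖u‖ ≤ C₂` on `Q(1/8)` gives
`|y'| ‖c u ∘ Φ‖ ≤ C₂` a.e. on every `Q(0, R)` that `Φ` maps into `Q(1/8)`
(`|(x_{k,3} e₃ + c y)'| = c |y'|`). [cite: SereginSverak2009, §4 (p10) from (p2) (arXiv p. 11)] -/
theorem ae_decay_rescaled {u : ℝ → ℝ³ → ℝ³} {C₂ c R : ℝ} (hc : 0 < c) (zk : ℝ × ℝ³)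
    (hC₂ : ∀ᵐ z ∂(volume.restrict (parCyl 0 (1 / 8))), cylRadius z.2 * ‖u z.1 z.2‖ ≤ C₂)
    (hmaps8 : parCyl 0 R ⊆ stAffine (c ^ 2) c zk.1 (zk.2 2 • eZ) ⁻¹' parCyl 0 (1 / 8)) :
    ∀ᵐ z ∂(volume.restrict (parCyl 0 R)),
      cylRadius z.2 * ‖(c • stPull (c ^ 2) c zk.1 (zk.2 2 • eZ) u) z.1 z.2‖ ≤ C₂ := by
  have h8 := ae_restrict_preimage_stAffine (sq_pos_of_pos hc) hc zk.1 (zk.2 2 • eZ) hC₂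
  filter_upwards [ae_restrict_of_ae_restrict_of_subset hmaps8 h8] with z hz
  simp only [stAffine_fst, stAffine_snd, cylRadius_smul_eZ_add, cylRadius_smul,
    abs_of_pos hc] at hz
  rw [smul_stPull_apply, norm_smul, Real.norm_eq_abs, abs_of_pos hc]
  calc cylRadius z.2 * (c * ‖u (zk.1 + c ^ 2 * z.1) (zk.2 2 • eZ + c • z.2)‖)
        = c * cylRadius z.2 * ‖u (zk.1 + c ^ 2 * z.1) (zk.2 2 • eZ + c • z.2)‖ := by ring
    _ ≤ C₂ := hz

/-- **Continuity up to `s = 0` of the rescaled representative** `V = c v ∘ Φ` on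
`𝒞(R) × ]-R², 0]`, when `Φ` maps that set into a backward cylinder contained in `Q`, where `v` is
continuous. [cite: SereginSverak2009, §4 ((p3), (p11): values at `s = 0`, arXiv p. 11)] -/
theorem continuousOn_rescaled {v : ℝ × ℝ³ → ℝ³} (hvc : ContinuousOn v (parCyl 0 1)) {c σ R : ℝ}
    (hc : 0 < c) (zk : ℝ × ℝ³) (hR : R + cylRadius (c⁻¹ • horiz zk.2) ≤ σ / c)
    (hσ : backCyl zk σ ⊆ parCyl 0 1) :
    ContinuousOn (fun z => c • v (stAffine (c ^ 2) c zk.1 (zk.2 2 • eZ) z)) (parCylTop R) := by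
  have hmaps : MapsTo (stAffine (c ^ 2) c zk.1 (zk.2 2 • eZ)) (parCylTop R) (parCyl 0 1) := by
    intro z hz
    rw [mem_parCylTop, mem_spaceCyl, sub_zero] at hz
    have h4 : |z.2 2| < R := by simpa using hz.2.2
    exact hσ (stAffine_mem_backCyl_of_mem hc zk hR hz.1.1 hz.1.2 hz.2.1 h4)
  exact (hvc.comp (continuous_stAffine _ _ _ _).continuousOn hmaps).const_smul c

end SereginSverak2009

end Literature.Analysis.FluidPDE
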